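import Mathlib
import Summits.Ventures.PercRepro2.SwOutCrossJunctionMarkExample

/-!
# An instance with THREE dropped components and the mark anywhere (blind cell PercRepro2,
night-4 g27, 2026-08-28; proofs/NIGHT4-G27.md §6″)

The graph `crossEx4` on `Fin 10` (`l = 0`, `h = 1`, the old mark `o = 2` with its edge to `l`,
the junction `u = 3`, the dropped vertices `4, 5` and `6, 7` joined by the cross edges `45`, `67`,
the single dropped vertex `8`, the u-arm `x = 9`) with sixteen edges: the cross-edge graph is the
nested sum `(⊤ ⊕g ⊤) ⊕g ⊤` on `(Fin 2 ⊕ Fin 2) ⊕ Fin 1` — THREE components.  The junction is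
proved by `decide` on the finite fields (the two that mention the region by `simp` first; the
sum graph's adjacency made decidable by `instDecidableRelSumAdj`), and
the mark may be any vertex: **`sw_crossEx4_mark : ∀ o, Sw crossEx4 0 1 o`** — in particular the
mark at a dropped vertex of a three-component cross graph (`sw_crossEx4_dropped`), which only
this seat's `sw_of_crossJunctionQ_any` covers.
-/

namespace Summit.Ventures.PercRepro2

namespace CrossArm

open Hull LocRows

/-- The adjacency of a disjoint sum of graphs is decidable when both summands' are (Mathlib's
`SimpleGraph.sum` carries no such instance; g25's instances used the classical one, which
`decide` cannot evaluate). -/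
instance instDecidableRelSumAdj {V W : Type*} (G : SimpleGraph V) (H : SimpleGraph W)
    [DecidableRel G.Adj] [DecidableRel H.Adj] : DecidableRel (G ⊕g H).Adj
  | Sum.inl u, Sum.inl v => inferInstanceAs (Decidable (G.Adj u v))
  | Sum.inr u, Sum.inr v => inferInstanceAs (Decidable (H.Adj u v))
  | Sum.inl _, Sum.inr _ => isFalse fun h => Bool.noConfusion h
  | Sum.inr _, Sum.inl _ => isFalse fun h => Bool.noConfusion h

/-- The three-component junction: `l = 0`, `h = 1`, `o = 2`, `u = 3`, the dropped vertices
`4, 5 | 6, 7 | 8`, the u-arm `x = 9`. -/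
def crossEx4 : Fin 16 → Sym2 (Fin 10) :=
  ![s(1, 9), s(3, 9), s(3, 4), s(3, 5), s(3, 6), s(3, 7), s(3, 8), s(4, 5), s(6, 7), s(9, 0),
    s(4, 0), s(5, 0), s(6, 0), s(7, 0), s(8, 0), s(2, 0)]

/-- The five dropped vertices in three components. -/
def crossEx4P : (Fin 2 ⊕ Fin 2) ⊕ Fin 1 → Fin 10 :=
  Sum.elim (Sum.elim ![4, 5] ![6, 7]) ![8]

/-- The cross-edge graph: the edges `45` and `67`, nothing at `8` — three components. -/
abbrev crossEx4G : SimpleGraph ((Fin 2 ⊕ Fin 2) ⊕ Fin 1) :=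
  ((⊤ : SimpleGraph (Fin 2)) ⊕g (⊤ : SimpleGraph (Fin 2))) ⊕g (⊤ : SimpleGraph (Fin 1))

/-- The cross junction of `crossEx4`, with three components. -/
theorem crossEx4_junction : CrossJunction crossEx4 ({0}ᶜ) 1 3 crossEx4P crossEx4G 2 where
  hne_hu := by decide
  hne_hp := by decide
  hne_up := by decide
  p_inj := by
    intro i j h
    revert i j
    decide
  hou := by decide
  hop := by decide
  hhU := by simp
  huU := by simp
  hpU := by
    intro i
    simp only [Set.mem_compl_iff, Set.mem_singleton_iff]
    revert i
    decide
  hloop_h := by decide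
  hloop_u := by decide
  hnadj := by decide
  hnadj_p := by decide
  hup := by decide
  hcross := by decide
  hcross_adj := by decide
  hcross_simple := by decide
  hu_adj_h := by decide
  hp_in := by
    intro i e x he hxU
    have hx : x ≠ 0 := by simpa using hxU
    revert i e x
    decide
  hout := by
    intro x hx hx1 hx2 hx3
    have hx' : x ≠ 0 := by simpa using hx
    revert x
    decide

/-- `crossEx4` is a cross junction with the mark at ANY vertex. -/
theorem crossEx4M_junction (o : Fin 10) :
    CrossJunctionM crossEx4 ({0}ᶜ) 1 3 crossEx4P crossEx4G o :=
  crossEx4_junction.toM.moveMark o (Or.inl ⟨15, 0, rfl, by simp⟩)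

/-- **Row (SW) on `crossEx4` with the mark at any vertex** (three dropped components). -/
theorem sw_crossEx4_mark (o : Fin 10) : Sw crossEx4 0 1 o :=
  sw_of_crossJunctionM (by decide) (crossEx4M_junction o)

/-- **Row (SW) on `crossEx4` with the mark at the dropped vertex `6`** — a three-component cross
graph with the mark at a dropped vertex. -/
theorem sw_crossEx4_dropped : Sw crossEx4 0 1 6 :=
  sw_crossEx4_mark 6

end CrossArm

end Summit.Ventures.PercRepro2
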